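import Summits.HubbardSuperconductivity.HubbardSuperconductivity.Theorems.DeformationLadderLadderThesisRigidityReduction
import Literature.MathematicalPhysics.QuantumLattice.BdGBondHamiltonian
import Literature.MathematicalPhysics.QuantumLattice.PairCorrelationsProofs
import Literature.MathematicalPhysics.QuantumLattice.HubbardGaugeBound

/-!
# Route `DeformationLadder`, crux `LowEnergyRigidity` (stmt-HubbardSuperconductivity-1892):
# charge twists of the Hubbard torus — gauge conjugation and the `±` energy bound

Support file (`--supports stmt-HubbardSuperconductivity-1892`), first half of the TWIST CEILING
(`TwistGap.TgTwistCeiling`, the tightness lemma every witness of `LowEnergyRigidity` /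
`LadderThesis` / `TgThesis` must respect). For a site-phase (gauge) function `g : Λ → U(1)` and the
tree's unitary `W_g = phaseGauge g`:

* `phaseGauge_conj_hamiltonian` — `W_g H(t,U) W_gᴴ` is the Hubbard Hamiltonian with the hopping
  `c†_{xσ}c_{yσ}` multiplied by `g_x conj(g_y)` (Peierls phases of a pure gauge), the interaction
  being gauge invariant;
* `re_expect_conj_add_conj_inv_le` — the `±` TWIST BOUND: for a unit vector `ψ`,
  `Re⟨ψ, W_g H W_gᴴ ψ⟩ + Re⟨ψ, W_{g⁻¹} H W_{g⁻¹}ᴴ ψ⟩ ≤ 2 Re⟨ψ, H ψ⟩ + |t| Σ_{x∼y,σ} (2 − 2 Re(g_x conj g_y))`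
  (the current terms of `g` and `g⁻¹ = conj g` cancel; `|⟨ψ, c†_{xσ}c_{yσ} ψ⟩| ≤ 1`).

Lieb–Schultz–Mattis, Ann. Phys. 16 (1961) 407 (twist operator); Koma–Tasaki, PRL 68 (1992) 3248,
eqs. (5)–(8) (site gauge); H. Watanabe, J. Stat. Phys. 177 (2019) 717, §2.2 (the `±` averaging of
the twisted variational energies). No definitions are introduced.
-/

set_option linter.dupNamespace false

noncomputable section

namespace Summit.HubbardSuperconductivity.HubbardSuperconductivity.Theorems.DeformationLadder

open Matrix Finset Literature.MathematicalPhysics.QuantumLattice Literature.Probability.LatticeModels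
open scoped Matrix.Norms.L2Operator ComplexOrder ComplexConjugate

/-! ### Gauge conjugation of the Hubbard Hamiltonian on a finite graph -/

section Graph

variable {Λ : Type*} [LinearOrder Λ] [Fintype Λ] (G : SimpleGraph Λ) [DecidableRel G.Adj]

/-- `z · conj z = 1` on the unit circle. [folklore] -/
theorem tc_circle_mul_conj (z : Circle) : (z : ℂ) * conj (z : ℂ) = 1 := by
  rw [Complex.mul_conj, Circle.normSq_coe, Complex.ofReal_one]

/-- **Gauge conjugation of the Hubbard Hamiltonian**: `W_g (c†_{xσ} c_{yσ}) W_gᴴ = g_x conj(g_y) c†_{xσ} c_{yσ}`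
and `W_g n_{x↑}n_{x↓} W_gᴴ = n_{x↑}n_{x↓}`, summed. Koma–Tasaki, PRL 68 (1992) 3248, eqs. (7)–(8).
[cite: KomaTasakiPRL1992, eqs. (7)–(8)] -/
theorem phaseGauge_conj_hamiltonian (g : Λ → Circle) (t U : ℝ) :
    phaseGauge g * hamiltonian G t U * (phaseGauge g)ᴴ =
      -(t : ℂ) • (∑ x : Λ, ∑ y : Λ, ∑ σ : Fin 2,
          if G.Adj x y then ((g x : ℂ) * conj (g y : ℂ)) • (creation (orb x σ) * annihilation (orb y σ))
          else 0) +
        (U : ℂ) • ∑ x : Λ, numberOp x 0 * numberOp x 1 := by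
  set W := phaseGauge g with hW
  have hnum : ∀ x : Λ, W * (numberOp x 0 * numberOp x 1) * Wᴴ = numberOp x 0 * numberOp x 1 := by
    intro x
    rw [hW, phaseGauge_mul_mul_mul_conjTranspose, phaseGauge_mul_numberOp_mul_conjTranspose,
      phaseGauge_mul_numberOp_mul_conjTranspose]
  have hhop : ∀ (x y : Λ) (σ : Fin 2),
      W * (if G.Adj x y then creation (orb x σ) * annihilation (orb y σ) else 0) * Wᴴ =
        (if G.Adj x y then ((g x : ℂ) * conj (g y : ℂ)) • (creation (orb x σ) * annihilation (orb y σ))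
          else 0) := by
    intro x y σ
    split_ifs
    · rw [hW, phaseGauge_mul_mul_mul_conjTranspose, phaseGauge_mul_creation_mul_conjTranspose,
        phaseGauge_mul_annihilation_mul_conjTranspose, smul_mul_smul_comm]
    · rw [Matrix.mul_zero, Matrix.zero_mul]
  unfold hamiltonian
  simp only [Matrix.mul_add, Matrix.add_mul, Matrix.mul_smul, Matrix.smul_mul, Finset.mul_sum,
    Finset.sum_mul, hnum, hhop]

/-- The expectation of the gauge-conjugated Hamiltonian in a vector `ψ`: hopping amplitudes
`⟨ψ, c†_{xσ}c_{yσ} ψ⟩` weighted by the Peierls phases, plus the gauge-invariant interaction.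
[cite: KomaTasakiPRL1992, eqs. (7)–(8)] -/
theorem expect_phaseGauge_conj_hamiltonian (g : Λ → Circle) (t U : ℝ) (ψ : Fock (Orb Λ)) :
    expect (phaseGauge g * hamiltonian G t U * (phaseGauge g)ᴴ) ψ =
      -(t : ℂ) * (∑ x : Λ, ∑ y : Λ, ∑ σ : Fin 2,
          if G.Adj x y then (g x : ℂ) * conj (g y : ℂ) *
            expect (creation (orb x σ) * annihilation (orb y σ)) ψ else 0) +
        (U : ℂ) * expect (∑ x : Λ, numberOp x 0 * numberOp x 1) ψ := by
  rw [phaseGauge_conj_hamiltonian, expect_add, expect_smul, expect_smul, expect_sum]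
  congr 2
  refine Finset.sum_congr rfl fun x _ => ?_
  rw [expect_sum]
  refine Finset.sum_congr rfl fun y _ => ?_
  rw [expect_sum]
  refine Finset.sum_congr rfl fun σ _ => ?_
  split_ifs
  · rw [expect_smul]
  · rw [Literature.MathematicalPhysics.QuantumLattice.expect, zero_mulVec, dotProduct_zero]

/-- The expectation of the Hubbard Hamiltonian itself (the case `g = 1`). [folklore] -/
theorem expect_hamiltonian_eq (t U : ℝ) (ψ : Fock (Orb Λ)) :
    expect (hamiltonian G t U) ψ =
      -(t : ℂ) * (∑ x : Λ, ∑ y : Λ, ∑ σ : Fin 2,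
          if G.Adj x y then expect (creation (orb x σ) * annihilation (orb y σ)) ψ else 0) +
        (U : ℂ) * expect (∑ x : Λ, numberOp x 0 * numberOp x 1) ψ := by
  have h := expect_phaseGauge_conj_hamiltonian G 1 t U ψ
  rw [phaseGauge_one, Matrix.one_mul, conjTranspose_one, Matrix.mul_one] at h
  rw [h]
  simp only [Pi.one_apply, Circle.coe_one, map_one, one_mul]

/-- A hopping amplitude in a unit vector has modulus `≤ 1`: `|⟨ψ, c†_{xσ} c_{yτ} ψ⟩| ≤ 1`
(`‖c†‖, ‖c‖ ≤ 1`). [folklore] -/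
theorem norm_expect_creation_mul_annihilation_le {ψ : Fock (Orb Λ)} (hψ : star ψ ⬝ᵥ ψ = 1)
    (x y : Λ) (σ τ : Fin 2) :
    ‖expect (creation (orb x σ) * annihilation (orb y τ)) ψ‖ ≤ 1 := by
  rw [Literature.MathematicalPhysics.QuantumLattice.expect]
  refine (norm_star_dotProduct_le_eucNorm hψ _).trans ?_
  refine (eucNorm_mulVec_le _ _).trans ?_
  rw [eucNorm_eq_one hψ, mul_one]
  refine (l2_opNorm_mul _ _).trans ?_
  exact mul_le_one₀ (norm_creation_le_one _) (norm_nonneg _) (norm_annihilation_le_one _)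

/-- On the unit circle `Re(z conj w) ≤ 1`. [folklore] -/
theorem tc_re_mul_conj_le_one (z w : Circle) : ((z : ℂ) * conj (w : ℂ)).re ≤ 1 := by
  refine (Complex.re_le_norm _).trans ?_
  rw [norm_mul, Complex.norm_conj, Circle.norm_coe, Circle.norm_coe, mul_one]

/-- **The `±` twist bound.** For a unit vector `ψ` and a gauge function `g`, the variational
energies of the two oppositely twisted copies `W_gᴴψ`, `W_{g⁻¹}ᴴψ` of `ψ` satisfy
`Re⟨ψ, W_g H W_gᴴ ψ⟩ + Re⟨ψ, W_{g⁻¹} H W_{g⁻¹}ᴴ ψ⟩ ≤ 2Re⟨ψ, Hψ⟩ + |t| Σ_{x ∼ y, σ} (2 − 2Re(g_x conj g_y))`: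
the terms linear in the bond currents cancel between `g` and `g⁻¹ = conj g`, and each hopping
amplitude has modulus `≤ 1`. Watanabe, J. Stat. Phys. 177 (2019) 717, §2.2 (the average of
`⟨U H U†⟩` and `⟨U† H U⟩`). [cite: Watanabe2019, §2.2] -/
theorem re_expect_conj_add_conj_inv_le (g : Λ → Circle) (t U : ℝ) {ψ : Fock (Orb Λ)}
    (hψ : star ψ ⬝ᵥ ψ = 1) :
    (expect (phaseGauge g * hamiltonian G t U * (phaseGauge g)ᴴ) ψ).re +
        (expect (phaseGauge g⁻¹ * hamiltonian G t U * (phaseGauge g⁻¹)ᴴ) ψ).re ≤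
      2 * (expect (hamiltonian G t U) ψ).re +
        |t| * ∑ x : Λ, ∑ y : Λ, ∑ _σ : Fin 2,
          if G.Adj x y then (2 - 2 * ((g x : ℂ) * conj (g y : ℂ)).re) else 0 := by
  -- hopping amplitudes `h` and the real weights `r = 2 Re(g_x conj g_y) - 2`
  set h : Λ → Λ → Fin 2 → ℂ := fun x y σ => expect (creation (orb x σ) * annihilation (orb y σ)) ψ
    with hh
  set r : Λ → Λ → ℝ := fun x y => 2 * ((g x : ℂ) * conj (g y : ℂ)).re - 2 with hr
  set S : ℂ := ∑ x : Λ, ∑ y : Λ, ∑ σ : Fin 2,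
    if G.Adj x y then ((r x y : ℝ) : ℂ) * h x y σ else 0 with hS
  have e3 : ∀ x y : Λ, (g x : ℂ) * conj (g y : ℂ) + (g⁻¹ x : ℂ) * conj (g⁻¹ y : ℂ) - 2 =
      ((r x y : ℝ) : ℂ) := by
    intro x y
    rw [hr, Pi.inv_apply, Pi.inv_apply, Circle.coe_inv_eq_conj, Circle.coe_inv_eq_conj,
      Complex.conj_conj]
    simp only
    push_cast
    rw [Complex.re_eq_add_conj, map_mul, Complex.conj_conj]
    ring
  have key : expect (phaseGauge g * hamiltonian G t U * (phaseGauge g)ᴴ) ψ +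
      expect (phaseGauge g⁻¹ * hamiltonian G t U * (phaseGauge g⁻¹)ᴴ) ψ -
        2 * expect (hamiltonian G t U) ψ = -(t : ℂ) * S := by
    rw [expect_phaseGauge_conj_hamiltonian, expect_phaseGauge_conj_hamiltonian,
      expect_hamiltonian_eq, hS]
    rw [show ∀ (A B C D : ℂ), (-(t : ℂ) * A + D) + (-(t : ℂ) * B + D) - 2 * (-(t : ℂ) * C + D) =
      -(t : ℂ) * (A + B - 2 * C) from fun A B C D => by ring]
    congr 1
    rw [Finset.mul_sum, ← Finset.sum_add_distrib, ← Finset.sum_sub_distrib]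
    refine Finset.sum_congr rfl fun x _ => ?_
    rw [Finset.mul_sum, ← Finset.sum_add_distrib, ← Finset.sum_sub_distrib]
    refine Finset.sum_congr rfl fun y _ => ?_
    rw [Finset.mul_sum, ← Finset.sum_add_distrib, ← Finset.sum_sub_distrib]
    refine Finset.sum_congr rfl fun σ _ => ?_
    split_ifs
    · rw [← e3]; ring
    · ring
  -- real parts
  have hre : (-(t : ℂ) * S).re = -t * ∑ x : Λ, ∑ y : Λ, ∑ σ : Fin 2,
      if G.Adj x y then r x y * (h x y σ).re else 0 := by
    rw [neg_mul, Complex.neg_re, Complex.re_ofReal_mul, hS, Complex.re_sum, neg_mul]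
    congr 2
    refine Finset.sum_congr rfl fun x _ => ?_
    rw [Complex.re_sum]
    refine Finset.sum_congr rfl fun y _ => ?_
    rw [Complex.re_sum]
    refine Finset.sum_congr rfl fun σ _ => ?_
    split_ifs
    · rw [Complex.re_ofReal_mul]
    · rfl
  have hbound : -t * ∑ x : Λ, ∑ y : Λ, ∑ σ : Fin 2,
      (if G.Adj x y then r x y * (h x y σ).re else 0) ≤
      |t| * ∑ x : Λ, ∑ y : Λ, ∑ _σ : Fin 2,
        if G.Adj x y then (2 - 2 * ((g x : ℂ) * conj (g y : ℂ)).re) else 0 := by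
    rw [neg_mul, ← mul_neg, ← Finset.sum_neg_distrib]
    refine (le_abs_self _).trans ?_
    rw [abs_mul]
    refine mul_le_mul_of_nonneg_left ?_ (abs_nonneg t)
    refine (Finset.abs_sum_le_sum_abs _ _).trans (Finset.sum_le_sum fun x _ => ?_)
    rw [← Finset.sum_neg_distrib]
    refine (Finset.abs_sum_le_sum_abs _ _).trans (Finset.sum_le_sum fun y _ => ?_)
    rw [← Finset.sum_neg_distrib]
    refine (Finset.abs_sum_le_sum_abs _ _).trans (Finset.sum_le_sum fun σ _ => ?_)
    split_ifs
    · have h1 : |(h x y σ).re| ≤ 1 :=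
        (Complex.abs_re_le_norm _).trans (norm_expect_creation_mul_annihilation_le hψ x y σ σ)
      have h2 : 0 ≤ 2 - 2 * ((g x : ℂ) * conj (g y : ℂ)).re := by
        linarith [tc_re_mul_conj_le_one (g x) (g y)]
      have h3 : -(r x y * (h x y σ).re) = (2 - 2 * ((g x : ℂ) * conj (g y : ℂ)).re) * (h x y σ).re := by
        rw [hr]; ring
      rw [h3, abs_mul, abs_of_nonneg h2]
      calc (2 - 2 * ((g x : ℂ) * conj (g y : ℂ)).re) * |(h x y σ).re|
          ≤ (2 - 2 * ((g x : ℂ) * conj (g y : ℂ)).re) * 1 := mul_le_mul_of_nonneg_left h1 h2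
        _ = 2 - 2 * ((g x : ℂ) * conj (g y : ℂ)).re := mul_one _
    · simp
  have hk := congrArg Complex.re key
  rw [Complex.sub_re, Complex.add_re, hre, Complex.mul_re] at hk
  simp only [Complex.re_ofNat, Complex.im_ofNat, zero_mul, sub_zero] at hk
  linarith

end Graph

/-! ### The charge twists of the two-dimensional torus -/

section Torus

variable (L : ℕ) [NeZero L]

/-- Vertices of the `d`-dimensional fermionic torus have at most `2d` neighbours (adapted from
`card_filter_fermionTorusGraph_adj_le` of `HubbardHighTemperatureTwoPoint`, kept private here to
avoid that file's cluster-expansion imports). [folklore] -/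
private theorem tc_card_filter_adj_le' {d : ℕ} (v : FermionTorus d L) :
    (Finset.univ.filter ((fermionTorusGraph d L).Adj v)).card ≤ 2 * d := by
  classical
  have hsub : (Finset.univ.filter ((fermionTorusGraph d L).Adj v)).image FermionTorus.toTorusSite ⊆
      (Finset.univ : Finset (Fin d × Bool)).image fun p =>
        if p.2 then v.toTorusSite + Pi.single p.1 1 else v.toTorusSite - Pi.single p.1 1 := by
    intro z hz
    obtain ⟨w, hw, rfl⟩ := Finset.mem_image.1 hz
    have hadj := (Finset.mem_filter.1 hw).2
    rw [fermionTorusGraph_adj, torusGraph_adj_iff] at hadj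
    obtain ⟨-, ⟨i, h⟩ | ⟨i, h⟩⟩ := hadj
    · exact Finset.mem_image.2 ⟨(i, true), Finset.mem_univ _, by simp [h]⟩
    · refine Finset.mem_image.2 ⟨(i, false), Finset.mem_univ _, ?_⟩
      simp only [if_false, Bool.false_eq_true]
      rw [h, add_sub_cancel_right]
  have hinj : Function.Injective (FermionTorus.toTorusSite : FermionTorus d L → TorusSite d L) :=
    FermionTorus.equivTorusSite.injective
  calc (Finset.univ.filter ((fermionTorusGraph d L).Adj v)).card
      = ((Finset.univ.filter ((fermionTorusGraph d L).Adj v)).image FermionTorus.toTorusSite).card :=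
        (Finset.card_image_of_injective _ hinj).symm
    _ ≤ ((Finset.univ : Finset (Fin d × Bool)).image fun p =>
          if p.2 then v.toTorusSite + Pi.single p.1 1 else v.toTorusSite - Pi.single p.1 1).card :=
        Finset.card_le_card hsub
    _ ≤ (Finset.univ : Finset (Fin d × Bool)).card := Finset.card_image_le
    _ = 2 * d := by
        rw [Finset.card_univ, Fintype.card_prod, Fintype.card_fin, Fintype.card_bool, mul_comm]

/-- Vertices of the two-dimensional fermionic torus have at most four neighbours. [folklore] -/
theorem tc_card_filter_adj_le (v : FermionTorus 2 L) :
    (Finset.univ.filter ((fermionTorusGraph 2 L).Adj v)).card ≤ 4 :=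
  tc_card_filter_adj_le' L v

/-- The real part of the standard character: `Re e^{2πi J/L} = cos(2π J.val/L)`. [folklore] -/
theorem tc_re_toCircle (J : ZMod L) :
    ((ZMod.toCircle J : Circle) : ℂ).re = Real.cos (2 * Real.pi * J.val / L) := by
  rw [ZMod.toCircle_apply]
  have h : (2 * Real.pi * Complex.I * (J.val : ℂ) / (L : ℂ) : ℂ) =
      ((2 * Real.pi * J.val / L : ℝ) : ℂ) * Complex.I := by
    push_cast; ring
  rw [h, Complex.exp_ofReal_mul_I_re]

/-- **The Peierls phase of a charge twist on a torus bond.** For the twist gauge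
`γ_J(z) = e^{2πi J z₁/L}` and adjacent sites `z ∼ w` of the torus,
`2 − 2 Re(γ_J(z) conj γ_J(w)) ≤ 2 − 2cos(2π J.val/L)`: vertical bonds carry no phase, horizontal
bonds the phase `e^{∓2πiJ/L}`. Lieb–Schultz–Mattis, Ann. Phys. 16 (1961) 407; Watanabe (2019)
§2.2.3. [cite: Watanabe2019, §2.2.3] -/
theorem tc_peierls_phase_le (J : ZMod L) {z w : FermionTorus 2 L}
    (hzw : (fermionTorusGraph 2 L).Adj z w) :
    2 - 2 * (((ZMod.toCircle (J * z.toTorusSite 0) : Circle) : ℂ) *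
        conj ((ZMod.toCircle (J * w.toTorusSite 0) : Circle) : ℂ)).re ≤
      2 - 2 * Real.cos (2 * Real.pi * J.val / L) := by
  -- `γ(z) conj γ(w) = e^{2πi J (z₁ - w₁)/L}`
  have hprod : ((ZMod.toCircle (J * z.toTorusSite 0) : Circle) : ℂ) *
      conj ((ZMod.toCircle (J * w.toTorusSite 0) : Circle) : ℂ) =
      ((ZMod.toCircle (J * (z.toTorusSite 0 - w.toTorusSite 0)) : Circle) : ℂ) := by
    rw [← Circle.coe_inv_eq_conj, ← AddChar.map_neg_eq_inv, ← Circle.coe_mul,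
      ← AddChar.map_add_eq_mul, mul_sub, sub_eq_add_neg]
  rw [hprod]
  rw [fermionTorusGraph_adj, torusGraph_adj_iff] at hzw
  obtain ⟨-, ⟨i, h⟩ | ⟨i, h⟩⟩ := hzw
  · -- `w = z + eᵢ`
    fin_cases i
    · have h0 : z.toTorusSite 0 - w.toTorusSite 0 = -1 := by
        rw [h]; simp
      rw [h0, mul_neg_one, AddChar.map_neg_eq_inv, Circle.coe_inv_eq_conj, Complex.conj_re,
        tc_re_toCircle]
    · have h0 : z.toTorusSite 0 - w.toTorusSite 0 = 0 := by
        rw [h]; simp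
      rw [h0, mul_zero, AddChar.map_zero_eq_one, Circle.coe_one, Complex.one_re]
      linarith [Real.cos_le_one (2 * Real.pi * J.val / L)]
  · -- `z = w + eᵢ`
    fin_cases i
    · have h0 : z.toTorusSite 0 - w.toTorusSite 0 = 1 := by
        rw [h]; simp
      rw [h0, mul_one, tc_re_toCircle]
    · have h0 : z.toTorusSite 0 - w.toTorusSite 0 = 0 := by
        rw [h]; simp
      rw [h0, mul_zero, AddChar.map_zero_eq_one, Circle.coe_one, Complex.one_re]
      linarith [Real.cos_le_one (2 * Real.pi * J.val / L)]

/-- **Energy of the `±J` charge twists of the Hubbard torus.** For a unit vector `ψ` and the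
twist gauge `γ_J(z) = e^{2πi J z₁/L}` (`W_J = phaseGauge γ_J`, the Lieb–Schultz–Mattis twist
`exp(2πi J Σ_x x₁ n_x / L)`),
`Re⟨ψ, W_J H W_Jᴴ ψ⟩ + Re⟨ψ, W_J⁻¹ H (W_J⁻¹)ᴴ ψ⟩ ≤ 2 Re⟨ψ, H ψ⟩ + 8L²(2 − 2cos(2πJ/L))`
for `H = hubbardTorus 2 L 1 U` (at most `4` neighbours per site, two spin states). Watanabe,
J. Stat. Phys. 177 (2019) 717, §2.2, §4.1. [cite: Watanabe2019, §2.2] -/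
theorem re_expect_twist_add_twist_inv_le (U : ℝ) (J : ZMod L) {ψ : Fock (Orb (FermionTorus 2 L))}
    (hψ : star ψ ⬝ᵥ ψ = 1) :
    (expect (phaseGauge (fun z : FermionTorus 2 L => ZMod.toCircle (J * z.toTorusSite 0)) *
        hubbardTorus 2 L 1 U *
        (phaseGauge (fun z : FermionTorus 2 L => ZMod.toCircle (J * z.toTorusSite 0)))ᴴ) ψ).re +
      (expect (phaseGauge (fun z : FermionTorus 2 L => ZMod.toCircle (J * z.toTorusSite 0))⁻¹ *
        hubbardTorus 2 L 1 U *
        (phaseGauge (fun z : FermionTorus 2 L => ZMod.toCircle (J * z.toTorusSite 0))⁻¹)ᴴ) ψ).re ≤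
      2 * (expect (hubbardTorus 2 L 1 U) ψ).re +
        8 * (L : ℝ) ^ 2 * (2 - 2 * Real.cos (2 * Real.pi * J.val / L)) := by
  have h := re_expect_conj_add_conj_inv_le (fermionTorusGraph 2 L)
    (fun z : FermionTorus 2 L => ZMod.toCircle (J * z.toTorusSite 0)) 1 U hψ
  rw [hubbardTorus]
  refine h.trans ?_
  rw [abs_one, one_mul]
  refine add_le_add le_rfl ?_
  -- bound the phase sum bond by bond, then count bonds
  set c : ℝ := 2 - 2 * Real.cos (2 * Real.pi * J.val / L) with hc
  have hc0 : 0 ≤ c := by rw [hc]; linarith [Real.cos_le_one (2 * Real.pi * J.val / L)]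
  calc ∑ x : FermionTorus 2 L, ∑ y : FermionTorus 2 L, ∑ _σ : Fin 2,
        (if (fermionTorusGraph 2 L).Adj x y then
          2 - 2 * (((ZMod.toCircle (J * x.toTorusSite 0) : Circle) : ℂ) *
            conj ((ZMod.toCircle (J * y.toTorusSite 0) : Circle) : ℂ)).re else 0)
      ≤ ∑ x : FermionTorus 2 L, ∑ y : FermionTorus 2 L, ∑ _σ : Fin 2,
          (if (fermionTorusGraph 2 L).Adj x y then c else 0) := by
        refine Finset.sum_le_sum fun x _ => Finset.sum_le_sum fun y _ =>
          Finset.sum_le_sum fun σ _ => ?_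
        split_ifs with hxy
        · exact tc_peierls_phase_le L J hxy
        · exact le_rfl
    _ = ∑ x : FermionTorus 2 L, 2 * (c * ((Finset.univ.filter ((fermionTorusGraph 2 L).Adj x)).card)) := by
        refine Finset.sum_congr rfl fun x _ => ?_
        rw [Finset.sum_comm, Finset.sum_const, Finset.card_univ, Fintype.card_fin, nsmul_eq_mul,
          Nat.cast_ofNat, ← Finset.sum_filter, Finset.sum_const, nsmul_eq_mul, mul_comm _ c]
    _ ≤ ∑ _x : FermionTorus 2 L, 2 * (c * 4) := by
        refine Finset.sum_le_sum fun x _ => ?_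
        have h4 : ((Finset.univ.filter ((fermionTorusGraph 2 L).Adj x)).card : ℝ) ≤ 4 := by
          exact_mod_cast tc_card_filter_adj_le L x
        nlinarith
    _ = 8 * (L : ℝ) ^ 2 * c := by
        rw [Finset.sum_const, Finset.card_univ, Summit.HubbardSuperconductivity.NoGo.card_fermionTorus_two,
          nsmul_eq_mul]
        push_cast
        ring

end Torus

end Summit.HubbardSuperconductivity.HubbardSuperconductivity.Theorems.DeformationLadder
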